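import Literature.NumberTheory.EllipticCurves.HidaFamilyGaloisRepDatum
import Literature.NumberTheory.EllipticCurves.OchiaiTwoVariableSelmerDual
import Summits.BirchSwinnertonDyer.BirchSwinnertonDyer.Theorems.OneSidedTwistSqueezeX9KatoDivisibilityX9ULedgerDefs
import Summits.BirchSwinnertonDyer.BirchSwinnertonDyer.Theorems.OneSidedTwistSqueezeX9KatoDivisibilityX9ULedgerFinTwoKernels
import Summits.BirchSwinnertonDyer.BirchSwinnertonDyer.Theorems.OneSidedTwistSqueezeX9KatoDivisibilityX9ULedgerNilpotentNormalForm

set_option autoImplicit false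

/-!
# Specialisation kernels of a Hida datum: (U)_v from fixed-point-free inertia, from UNIMODULAR monodromy,
# and from the tame relation (helpers for crux stmt-BirchSwinnertonDyer-20547 `KatoDivisibilityX9`, stub 3 (U))

Port (verbatim, re-homed) of §B and the datum half of §D of the bsd-f3-mu cell's kernel-checked sketch `Sketch71.lean`
v5 f376123484d02b28 (planner-bsd-f3-mu-desc g71; port plan PORT-PLAN-72 file P5 first half, desc g72).  For a Hida datum
`D : HidaFamilyGaloisRepDatum W p 𝕀` (tree) and a finite place `v` of `ℚ`, with the vocabulary of `…ULedgerDefs.lean`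
(`D.rhoMat`, `D.OneParamInertiaAt`, `D.UnimodularMonodromyAt`, `D.MonodromyShallowAt`, `nilMat`, `outerNil`):

* `inertiaCoinvariantsKer_eq_range` — under one-parameter inertia through `τ` the inertia coboundaries ARE the range of
  `ν = ρ_D(τ) − 1`; `specialisationTorsionFreeAt_of_unimodular` — LEMMA 71.2 (a): unimodular monodromy and
  `P_W = (ϖ)` principal ⟹ `D.SpecialisationTorsionFreeAt v`;
* `specialisationTorsionFreeAt_of_isUnit`, `isUnit_rhoMat_sub_one_of_fixedPointFree`,
  `specialisationTorsionFreeAt_of_fixedPointFree` — the ADDITIVE half (unit trick D71′): if some `σ ∈ I_v` fixes no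
  non-zero point of `E[p]`, then `ρ_D(σ) − 1 ∈ GL₂(𝕀)` by residual conjugacy (vi) and locality, `(𝕀²)_{I_v} = 0`, and
  `(U)_v` holds for EVERY datum (no (Reg), no (inj), no weight-two input) [Ochiai 2006 §3 Lemma 3.2 / Rem. 7.6, made
  unconditional];
* `unimodularMonodromyAt_of_outerNil`; `specialisationTorsionFreeAt_of_shallow` — PROP 71.4, kernel form: (Reg),
  one-parameter inertia, square-zero monodromy, the one-point test `MonodromyShallowAt` and `P_W` principal ⟹ `(U)_v`;
* `sq_zero_of_tame_relation` — LEMMA 71.1 instantiated: the tame relation `ρ_D(φ τ φ⁻¹) = ρ_D(τ^ℓ)`, `ℓ ≥ 2`, and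
  `ρ_W(τ)` unipotent on `T_p W` force `(ρ_D(τ) − 1)² = 0` (via `unipotent_of_conj_pow`);
  `specialisationTorsionFreeAt_of_tame_shallow` — PROP 71.4 with the tame relation.

Not ported (superseded first-form additive route of the sketch): `FiniteInertiaImageAt`,
`inertiaCoinvariantsKer_eq_span_image`, `specialisationTorsionFreeAt_of_finiteInertiaImage`.  The weight-two test
(`MonodromyShallowAt` from the depth digit under (W2ℚ_p)) is `…ULedgerWeightTwoTest.lean`.  No ledger item is closed
here; BSD is proved for no curve.  References: [Ochiai2006] §3 Lemma 3.2, Thm. 3.3, Cor. 7.5 / Rem. 7.6; [Hida1986].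
-/

noncomputable section

open scoped Classical MatrixGroups NumberField
open Matrix

namespace Literature.NumberTheory.EllipticCurves.HidaFamilyGaloisRepDatum

open Literature.NumberTheory.EllipticCurves Literature.NumberTheory.GaloisRepresentations
open Field IsDedekindDomain NumberField
open Summit.BirchSwinnertonDyer.BirchSwinnertonDyer.Theorems.OneSidedTwistSqueezeX9KatoDivisibilityX9ULedger
open Literature.NumberTheory.Automorphic (matrixTwo_mul_self)

variable {W : WeierstrassCurve ℚ} {p : ℕ} [Fact p.Prime] {I : Type} [CommRing I] [IsDomain I]
  [IsLocalRing I] [TopologicalSpace I] [IsTopologicalRing I] [Algebra (IwasawaAlgebra p) I]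
  (D : HidaFamilyGaloisRepDatum W p I)

/-! ## §B. One-parameter inertia, unimodular monodromy, the unit trick -/

/-- Under (G), the module of inertia coboundaries IS the range of the monodromy `ν = ρ(τ) − 1`. -/
theorem inertiaCoinvariantsKer_eq_range {v : HeightOneSpectrum (𝓞 ℚ)} {τ : absoluteGaloisGroup ℚ}
    (hτ : D.OneParamInertiaAt v τ) :
    D.inertiaCoinvariantsKer v = LinearMap.range (Matrix.mulVecLin (D.rhoMat τ - 1)) := by
  obtain ⟨hτI, hgen⟩ := hτ
  apply le_antisymm
  · rw [inertiaCoinvariantsKer]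
    apply Submodule.span_le.mpr
    rintro z ⟨σ, hσ, y, rfl⟩
    obtain ⟨s, hs⟩ := hgen σ hσ
    refine ⟨s • y, ?_⟩
    rw [Matrix.mulVecLin_apply, Matrix.mulVec_smul, FramedRep.toRepresentation_apply_apply]
    have : D.rhoMat σ *ᵥ y - y = (D.rhoMat σ - 1) *ᵥ y := by
      rw [Matrix.sub_mulVec, Matrix.one_mulVec]
    rw [this, hs, Matrix.smul_mulVec]
  · rintro z ⟨y, rfl⟩
    rw [inertiaCoinvariantsKer]
    apply Submodule.subset_span
    refine ⟨τ, hτI, y, ?_⟩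
    rw [Matrix.mulVecLin_apply, FramedRep.toRepresentation_apply_apply, Matrix.sub_mulVec, Matrix.one_mulVec]

/-- **PROP 71.2 (a), typed: one-parameter inertia + unimodular monodromy not dying at `W` + `P_W = (ϖ)` principal
(automatic under `(Reg)`: `𝕀` is a UFD by `Ochiai2006.IsRegular.uniqueFactorizationMonoid`, and `P_W` has height one)
⟹ Ochiai's `(U)_v = D.SpecialisationTorsionFreeAt v`.** -/
theorem specialisationTorsionFreeAt_of_unimodular {v : HeightOneSpectrum (𝓞 ℚ)} {τ : absoluteGaloisGroup ℚ}
    (hτ : D.OneParamInertiaAt v τ) (hU : D.UnimodularMonodromyAt τ) {ϖ : I} (hϖ : Prime ϖ)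
    (hker : RingHom.ker D.specW = Ideal.span {ϖ}) : D.SpecialisationTorsionFreeAt v := by
  obtain ⟨B, B', hB, hB', h, hh, hν⟩ := hU
  have hh' : ¬ ϖ ∣ h := by
    rw [hker, Ideal.mem_span_singleton] at hh
    exact hh
  intro m hm
  have hS : D.inertiaCoinvariantsKer v = LinearMap.range (Matrix.mulVecLin (B * nilMat h * B')) := by
    rw [D.inertiaCoinvariantsKer_eq_range hτ, hν]
  refine coker_torsionFree_of_unimodular ϖ h hϖ hh' B B' hB hB' (D.inertiaCoinvariantsKer v) hS m ?_
  intro a ha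
  exact hm a (by rw [hker]; exact ha)

/-- **THE UNIT TRICK (additive primes): one inertia element `σ` with `ρ(σ) − 1 ∈ GL₂(𝕀)` kills the
inertia coinvariants outright** — `(𝕀²)_{I_v} = 0`, so `(U)_v` holds for trivial reasons (no `(Reg)`, no
`(inj)`, no weight-two input). -/
theorem specialisationTorsionFreeAt_of_isUnit {v : HeightOneSpectrum (𝓞 ℚ)} {σ : absoluteGaloisGroup ℚ}
    (hσ : σ ∈ GreenbergSelmer.inertia v) (hu : IsUnit (D.rhoMat σ - 1)) :
    D.SpecialisationTorsionFreeAt v := by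
  have htop : D.inertiaCoinvariantsKer v = ⊤ := by
    rw [eq_top_iff]
    intro x _
    obtain ⟨u, hu'⟩ := hu
    -- `x = (ρ σ − 1) y` with `y = (ρ σ − 1)⁻¹ x`
    have hx : x = (D.rhoMat σ - 1) *ᵥ (((u⁻¹ : (Matrix (Fin 2) (Fin 2) I)ˣ) : Matrix (Fin 2) (Fin 2) I) *ᵥ x) := by
      rw [Matrix.mulVec_mulVec, ← hu', Units.mul_inv, Matrix.one_mulVec]
    rw [hx, Matrix.sub_mulVec, Matrix.one_mulVec]
    exact Submodule.subset_span ⟨σ, hσ, _, by rw [FramedRep.toRepresentation_apply_apply]⟩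
  intro m _
  induction m using Submodule.Quotient.induction_on with
  | H x =>
    rw [Submodule.Quotient.mk_eq_zero, htop]
    exact Submodule.mem_top

/-- **RESIDUAL LIFT of the unit trick.**  If `σ` fixes no non-zero `p`-torsion point of `E`, then
`ρ_𝓕(σ) − 1` is invertible over `𝕀`: by (vi) `exists_conj_residual`, `ρ_𝓕(σ) mod 𝔪` is conjugate to the
matrix of `σ` on `E[p]`, whose "minus one" is injective on `𝔽_p²`, so `det(ρ_𝓕(σ) − 1) ∉ 𝔪`. -/
theorem isUnit_rhoMat_sub_one_of_fixedPointFree (σ : absoluteGaloisGroup ℚ)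
    (hfix : ∀ Q : W.geomTorsion (p : ℤ), σ • Q = Q → Q = 0) : IsUnit (D.rhoMat σ - 1) := by
  classical
  haveI : CharP (IsLocalRing.ResidueField I) p := D.charP_residueField
  obtain ⟨e, P, hP⟩ := D.exists_conj_residual
  -- the map `x ↦ e⁻¹(σ • e x)` on `𝔽_p²`, as a `ZMod p`-linear map, and its matrix `M₀`
  let f : (Fin 2 → ZMod p) →+ (Fin 2 → ZMod p) :=
    (e.symm.toAddMonoidHom.comp (DistribSMul.toAddMonoidHom (W.geomTorsion (p : ℤ)) σ)).comp
      e.toAddMonoidHom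
  let fl : (Fin 2 → ZMod p) →ₗ[ZMod p] (Fin 2 → ZMod p) := f.toZModLinearMap p
  have hfl : ∀ x, fl x = e.symm (σ • e x) := fun x => rfl
  set M₀ : Matrix (Fin 2) (Fin 2) (ZMod p) := LinearMap.toMatrix' fl with hM₀
  have hM₀x : ∀ x, M₀ *ᵥ x = e.symm (σ • e x) := by
    intro x; rw [hM₀, LinearMap.toMatrix'_mulVec, hfl]
  -- `M₀ − 1` is injective on `𝔽_p²` (fixed-point freeness), hence a unit
  have hinj : Function.Injective (M₀ - 1).mulVec := by
    intro x y hxy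
    rw [Matrix.sub_mulVec, Matrix.sub_mulVec, Matrix.one_mulVec, Matrix.one_mulVec, hM₀x, hM₀x] at hxy
    have h1 : e.symm (σ • e (x - y)) = x - y := by
      rw [map_sub, smul_sub, map_sub]
      exact sub_eq_sub_iff_sub_eq_sub.mp hxy
    have h2 : σ • e (x - y) = e (x - y) := by
      have := congrArg e h1
      rwa [AddEquiv.apply_symm_apply] at this
    have h3 : e (x - y) = 0 := hfix _ h2
    have h4 : x - y = 0 := by
      have := congrArg e.symm h3
      rwa [AddEquiv.symm_apply_apply, map_zero] at this
    exact sub_eq_zero.mp h4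
  have hunit0 : IsUnit (M₀ - 1) := Matrix.mulVec_injective_iff_isUnit.mp hinj
  have hdet0 : (M₀ - 1).det ≠ 0 := ((Matrix.isUnit_iff_isUnit_det _).mp hunit0).ne_zero
  -- transport to the residue field `𝔽 = 𝕀/𝔪` along the (injective) cast `ZMod p → 𝔽`
  let c : ZMod p →+* IsLocalRing.ResidueField I := ZMod.castHom (dvd_refl p) (IsLocalRing.ResidueField I)
  have hc : Function.Injective c := c.injective
  have hMat : Matrix.of (fun i j : Fin 2 =>
      ((e.symm (σ • e (Pi.single j 1)) i : ZMod p).cast : IsLocalRing.ResidueField I)) = M₀.map c := by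
    ext i j
    rw [Matrix.of_apply, Matrix.map_apply, ZMod.castHom_apply, hM₀, LinearMap.toMatrix'_apply, hfl]
  have hdetc : (M₀.map c - 1).det ≠ 0 := by
    have hmap : M₀.map c - 1 = (M₀ - 1).map c := by
      rw [Matrix.map_sub c (fun a b => map_sub c a b), Matrix.map_one c (map_zero c) (map_one c)]
    rw [hmap, ← RingHom.mapMatrix_apply, ← RingHom.map_det]
    exact fun h => hdet0 (hc (by rw [h, map_zero]))
  -- the residual conjugacy `ρ(σ) mod 𝔪 = P · M₀ · P⁻¹`
  have hres : (D.rhoMat σ - 1).map (IsLocalRing.residue I) =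
      (P : Matrix (Fin 2) (Fin 2) (IsLocalRing.ResidueField I)) * (M₀.map c - 1) *
        ((P⁻¹ : GL (Fin 2) (IsLocalRing.ResidueField I)) :
          Matrix (Fin 2) (Fin 2) (IsLocalRing.ResidueField I)) := by
    rw [Matrix.map_sub (IsLocalRing.residue I) (fun a b => map_sub _ a b),
      Matrix.map_one (IsLocalRing.residue I) (map_zero _) (map_one _)]
    rw [show (D.rhoMat σ).map (IsLocalRing.residue I) = _ from hP σ, hMat, mul_sub, sub_mul, mul_one,
      ← Matrix.GeneralLinearGroup.coe_mul, mul_inv_cancel, Matrix.GeneralLinearGroup.coe_one]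
  have hdetres : ((D.rhoMat σ - 1).map (IsLocalRing.residue I)).det ≠ 0 := by
    rw [hres]
    rw [show (P : Matrix (Fin 2) (Fin 2) (IsLocalRing.ResidueField I)) * (M₀.map c - 1) *
        ((P⁻¹ : GL (Fin 2) (IsLocalRing.ResidueField I)) : Matrix (Fin 2) (Fin 2) _) =
        P.val * (M₀.map c - 1) * P⁻¹.val from rfl, Matrix.det_units_conj]
    exact hdetc
  -- so `det(ρ(σ) − 1) ∉ 𝔪`, i.e. it is a unit
  have hdetI : IsUnit (D.rhoMat σ - 1).det := by
    rw [← IsLocalRing.notMem_maximalIdeal, ← IsLocalRing.residue_eq_zero_iff, RingHom.map_det,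
      RingHom.mapMatrix_apply]
    exact hdetres
  exact (Matrix.isUnit_iff_isUnit_det _).mpr hdetI

/-- **(U)_v FROM FIXED-POINT FREENESS ON `E[p]`** (the two previous theorems): if some `σ ∈ I_v` fixes
no non-zero point of `E[p]`, then `(𝕀²)_{I_v} = 0` for EVERY datum `D`, and `D.SpecialisationTorsionFreeAt v`. -/
theorem specialisationTorsionFreeAt_of_fixedPointFree {v : HeightOneSpectrum (𝓞 ℚ)}
    {σ : absoluteGaloisGroup ℚ} (hσ : σ ∈ GreenbergSelmer.inertia v)
    (hfix : ∀ Q : W.geomTorsion (p : ℤ), σ • Q = Q → Q = 0) : D.SpecialisationTorsionFreeAt v :=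
  D.specialisationTorsionFreeAt_of_isUnit hσ (D.isUnit_rhoMat_sub_one_of_fixedPointFree σ hfix)

/-! ## §D. Normal form ⟹ unimodular; the tame relation ⟹ square-zero monodromy -/

/-- **LEMMA 71.2 (a) ⟸ unimodular direction.** If the monodromy is `h • outerNil e₁ e₂` with a UNIT coordinate
and `h ∉ P_W`, it is conjugate over `𝕀` to the elementary nilpotent `N(h)`: `UnimodularMonodromyAt`. -/
theorem unimodularMonodromyAt_of_outerNil {τ : absoluteGaloisGroup ℚ} {h e₁ e₂ : I}
    (hν : D.rhoMat τ - 1 = h • outerNil e₁ e₂) (hu : IsUnit e₁ ∨ IsUnit e₂)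
    (hh : h ∉ RingHom.ker D.specW) : D.UnimodularMonodromyAt τ := by
  rcases hu with ⟨u, rfl⟩ | ⟨u, rfl⟩
  · obtain ⟨h1, h2⟩ := basis_mul_adj (↑u : I) e₂ 0 (↑u⁻¹ : I) (by simp)
    exact ⟨_, _, h1, h2, h, hh, by rw [hν, conj_nilMat_eq]⟩
  · obtain ⟨h1, h2⟩ := basis_mul_adj e₁ (↑u : I) (-(↑u⁻¹ : I)) 0 (by simp)
    exact ⟨_, _, h1, h2, h, hh, by rw [hν, conj_nilMat_eq]⟩

/-- **PROP 71.4, KERNEL FORM.**  `(U)_v` for a datum over a regular `𝕀` from: one-parameter inertia through `τ`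
(STEP 1), square-zero monodromy (Lemma 71.1 `unipotent_of_conj_pow`), the one-point test, and `P_W = (ϖ)` principal
(a height-one prime of the factorial `𝕀`).  Composition: `exists_normalForm` (Lemma 71.2) ∘
`unimodularMonodromyAt_of_outerNil` ∘ `specialisationTorsionFreeAt_of_unimodular`. -/
theorem specialisationTorsionFreeAt_of_shallow {v : HeightOneSpectrum (𝓞 ℚ)} {τ : absoluteGaloisGroup ℚ}
    (hreg : Ochiai2006.IsRegular p I) (hτ : D.OneParamInertiaAt v τ)
    (hsq : (D.rhoMat τ - 1) * (D.rhoMat τ - 1) = 0) (htest : D.MonodromyShallowAt τ)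
    {ϖ : I} (hϖ : Prime ϖ) (hker : RingHom.ker D.specW = Ideal.span {ϖ}) :
    D.SpecialisationTorsionFreeAt v := by
  haveI := hreg.uniqueFactorizationMonoid
  obtain ⟨h, e₁, e₂, hrel, hν⟩ := exists_normalForm (D.rhoMat τ - 1) hsq
  obtain ⟨hu, hh⟩ := htest h e₁ e₂ hν hrel
  exact D.specialisationTorsionFreeAt_of_unimodular hτ (D.unimodularMonodromyAt_of_outerNil hν hu hh) hϖ hker

/-- **LEMMA 71.1 INSTANTIATED (STEP 1b in the kernel).**  If `ρ_D(φ τ φ⁻¹) = ρ_D(τ ^ ℓ)` with `ℓ ≥ 2` (the TAME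
RELATION: `φ` a Frobenius lift, `τ ∈ I_v` mapping to a topological generator of the `ℤ_p(1)`-quotient `t_p` of
inertia at `v ∤ p`; `φ τ φ⁻¹ ≡ τ^ℓ (mod ker t_p)` and `ρ_D|I_v` factors through `t_p` because `ρ̄_W(I_v) = 1` makes
`ρ_D(I_v) ⊂ 1 + M₂(𝔪_𝕀)` pro-`p` — STEP 1a, paper) and `ρ_W(τ)` is unipotent on `T_p W` (`det = 1`, `tr = 2`: the
Tate-curve digit at a multiplicative prime of an X9 pair, `E`-level), then the family monodromy `ν = ρ_D(τ) − 1`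
has square zero.  Proof: field (v) (`exists_conj_galoisRepTate`) gives `det ρ_D(τ) ≡ 1`, `tr ρ_D(τ) ≡ 2
(mod P_W = ker specW)`; `ℓ − 1, ℓ² − 1 ∉ P_W` since `specW` is `ℤ`-linear into characteristic `0`; then Lemma 71.1
`unipotent_of_conj_pow`. -/
theorem sq_zero_of_tame_relation {τ φ : absoluteGaloisGroup ℚ} {ℓ : ℕ} (hℓ : 2 ≤ ℓ)
    (hrel : D.rhoMat (φ * τ * φ⁻¹) = D.rhoMat (τ ^ ℓ)) (hdetW : LinearMap.det (W.galoisRepTate p τ) = 1)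
    (htrW : LinearMap.trace ℤ_[p] _ (W.galoisRepTate p τ) = 2) :
    (D.rhoMat τ - 1) * (D.rhoMat τ - 1) = 0 := by
  haveI : (RingHom.ker D.specW).IsPrime := RingHom.ker_isPrime D.specW
  obtain ⟨b, P, -, -, hconj⟩ := D.exists_conj_galoisRepTate
  set ιZ : ℤ_[p] →+* PadicAlgCl p := (algebraMap ℚ_[p] (PadicAlgCl p)).comp PadicInt.Coe.ringHom with hιZ
  set M : Matrix (Fin 2) (Fin 2) ℤ_[p] := LinearMap.toMatrix b b (W.galoisRepTate p τ) with hM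
  have hmapτ : (D.rhoMat τ).map D.specW =
      ((P : GL (Fin 2) (PadicAlgCl p)) : Matrix (Fin 2) (Fin 2) (PadicAlgCl p)) * ιZ.mapMatrix M *
        ((P⁻¹ : GL (Fin 2) (PadicAlgCl p)) : Matrix (Fin 2) (Fin 2) (PadicAlgCl p)) := by
    rw [rhoMat, hconj τ]
    rfl
  refine unipotent_of_conj_pow (RingHom.ker D.specW) (D.rhoMat τ) (D.rhoMat φ) (D.rhoMat φ⁻¹) ?_ ℓ ?_ ?_
    ?_ ?_ ?_
  · rw [rhoMat, rhoMat, ← Units.val_mul, ← map_mul, inv_mul_cancel, map_one, Units.val_one]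
  · have h3 : D.rhoMat φ * D.rhoMat τ * D.rhoMat φ⁻¹ = D.rhoMat (φ * τ * φ⁻¹) := by
      rw [rhoMat, rhoMat, rhoMat, rhoMat, ← Units.val_mul, ← Units.val_mul, ← map_mul, ← map_mul]
    rw [h3, hrel, rhoMat, rhoMat, map_pow, Units.val_pow_eq_pow_val]
  · rw [RingHom.mem_ker, map_sub, map_natCast, map_one, sub_eq_zero, Nat.cast_eq_one]
    omega
  · rw [RingHom.mem_ker, map_sub, map_pow, map_natCast, map_one, sub_eq_zero]
    have h4 : (4 : ℕ) ≤ ℓ ^ 2 := by nlinarith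
    intro h
    have h' : ((ℓ ^ 2 : ℕ) : PadicAlgCl p) = ((1 : ℕ) : PadicAlgCl p) := by push_cast; exact h
    have := Nat.cast_injective h'
    omega
  · rw [RingHom.mem_ker, map_sub, map_one, RingHom.map_det, RingHom.mapMatrix_apply, hmapτ,
      Matrix.det_units_conj, ← RingHom.map_det, hM, LinearMap.det_toMatrix, hdetW, map_one, sub_self]
  · have h1 : D.specW (D.rhoMat τ).trace = ((D.rhoMat τ).map D.specW).trace := by
      simp [Matrix.trace_fin_two]
    have h2 : ιZ M.trace = (ιZ.mapMatrix M).trace := by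
      simp [Matrix.trace_fin_two]
    rw [RingHom.mem_ker, map_sub, map_ofNat, h1, hmapτ, Matrix.trace_units_conj, ← h2, hM,
      ← LinearMap.trace_eq_matrix_trace, htrW, map_ofNat, sub_self]

/-- **PROP 71.4, KERNEL FORM WITH THE TAME RELATION.**  `(U)_v` from: one-parameter inertia through `τ`, the tame
relation `ρ_D(φ τ φ⁻¹) = ρ_D(τ^ℓ)` (`ℓ ≥ 2`), `ρ_W(τ)` unipotent on `T_p W`, `𝕀` regular, the one-point test, and
`P_W = (ϖ)` principal. -/
theorem specialisationTorsionFreeAt_of_tame_shallow {v : HeightOneSpectrum (𝓞 ℚ)}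
    {τ φ : absoluteGaloisGroup ℚ} {ℓ : ℕ} (hreg : Ochiai2006.IsRegular p I) (hτ : D.OneParamInertiaAt v τ)
    (hℓ : 2 ≤ ℓ) (hrel : D.rhoMat (φ * τ * φ⁻¹) = D.rhoMat (τ ^ ℓ))
    (hdetW : LinearMap.det (W.galoisRepTate p τ) = 1)
    (htrW : LinearMap.trace ℤ_[p] _ (W.galoisRepTate p τ) = 2) (htest : D.MonodromyShallowAt τ)
    {ϖ : I} (hϖ : Prime ϖ) (hker : RingHom.ker D.specW = Ideal.span {ϖ}) :
    D.SpecialisationTorsionFreeAt v :=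
  D.specialisationTorsionFreeAt_of_shallow hreg hτ (D.sq_zero_of_tame_relation hℓ hrel hdetW htrW) htest hϖ hker

end Literature.NumberTheory.EllipticCurves.HidaFamilyGaloisRepDatum
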